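import Summits.AtomisticToContinuum.HydrodynamicLimit.Theorems.InformationPercolationEngineChaosClosesEulerReductionEntropyPoint
import Summits.AtomisticToContinuum.HydrodynamicLimit.Theorems.InformationPercolationEngineChaosClosesEulerReductionTransport
import Summits.AtomisticToContinuum.HydrodynamicLimit.Theorems.InformationPercolationEngineChaosClosesEulerReductionStrip
import Summits.AtomisticToContinuum.HydrodynamicLimit.Theorems.InformationPercolationEngineChaosClosesEulerReductionSmooth
import HarnessLib

/-!
# Kinetic reduction (crux `ChaosClosesEuler`, stmt-AtomisticToContinuum-15141, line `Sketch`,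
# stub `stub_kineticReduction`) — helper: the entropy functional along one orbit (integrands and tests)

WHAT. Two ingredients of the pathwise step of (H3):

* along ONE good orbit, the entropy integrand `ρ_r Z q₁ + Z ⟪m_r, q₂⟫` with the clamped-law weight
  `Z = Z_L(ρ_r, θ_r)` (`|Z| ≤ Z_m = max |a₁| |b₁|`) and classical data `(q₁, q₂)` continuous on the strip
  `[0, b] × 𝕋³` is kinetically dominated (`entropy_integrands`; helper `ReductionTransport`), hence two such double
  integrals with nearby data are close (`entropy_sub`);
* the test fed to the clamped local second law for the window starting at `τ₀`:
  `φ(s, x) = ramp(s) θ(s + e, x) cut(τ₀, s)`, `ramp` smooth (`0` below `−e/2`, `1` above `−e/4`), `cut` the shell's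
  time cut-off: smooth on all of space–time, nonnegative, vanishing from `τ₀ + Δ` on, with the expected time
  derivative, gradient and initial value (`entropyTest_*`).

No named fact is invoked.
-/

noncomputable section

namespace Summit.AtomisticToContinuum.HydrodynamicLimit.Theorems.ChaosClosesEulerReduction

open scoped BigOperators Topology Classical MeasureTheory InnerProductSpace ContDiff
open Filter Set MeasureTheory Function
open Literature.MathematicalPhysics.KineticTheory
open Literature.Analysis.FluidPDE
open Literature.Analysis.FunctionSpaces
open Summit.AtomisticToContinuum.HydrodynamicLimit.Theorems.LocalSecondLawNegative
open Summit.AtomisticToContinuum.HydrodynamicLimit.Theorems.LocalSecondLawLedger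

variable {N : ℕ}

/-! ## §1 The entropy integrand along one orbit -/

/-- **The entropy integrand is a.e. measurable whenever its factors are.** [folklore] -/
theorem aemeasurable_entropy_recipe {α : Type*} [MeasurableSpace α] {ν : Measure α} {ρ Z q₁ : α → ℝ} {m q₂ : α → V3}
    (hρ : AEMeasurable ρ ν) (hZ : AEMeasurable Z ν) (hq₁ : AEMeasurable q₁ ν) (hm : AEMeasurable m ν)
    (hq₂ : AEMeasurable q₂ ν) : AEMeasurable (fun a => ρ a * Z a * q₁ a + Z a * ⟪m a, q₂ a⟫_ℝ) ν :=
  ((hρ.mul hZ).mul hq₁).add (hZ.mul (hm.inner hq₂))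

section Orbit

variable {σ : ℝ} (hσ : 0 ≤ σ) (Φ : HardSphereFlow (Torus.geometry (Fin 3)) (hsDiameter σ N) (N + 1)) {z : Phase N}
  (hz : z ∈ Φ.good) {r : ℝ} (hr : 0 < r) (hr2 : r < 1 / 2) {b : ℝ} (hb : 0 ≤ b) {a₁ b₁ : ℝ} {Fc : ℝ → ℝ}
  (hFc : ContinuousOn Fc (Ici 0))

include hσ hz hr hr2 hb hFc in
/-- **Kinetic domination of the entropy integrand along one orbit.** For classical data `q₁` (scalar) and `q₂`
(vector) continuous on `[0, b] × 𝕋³` with `|q₁| ≤ Q₁`, `‖q₂‖ ≤ Q₂`, the integrand `ρ_r Z_L q₁ + Z_L⟪m_r, q₂⟫` satisfies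
the conclusions of `spaceTime_bounds` with constants `(0, Z_m Q₂, Z_m Q₁ + Z_m Q₂/2)`. [folklore] -/
theorem entropy_integrands {q₁ : ℝ → T3 → ℝ} {q₂ : ℝ → T3 → V3}
    (hq₁ : ContinuousOn (uncurry q₁) (Icc 0 b ×ˢ univ)) (hq₂ : ContinuousOn (uncurry q₂) (Icc 0 b ×ˢ univ))
    {Q₁ Q₂ : ℝ} (hQ₁ : ∀ s ∈ Icc 0 b, ∀ x, |q₁ s x| ≤ Q₁) (hQ₂ : ∀ s ∈ Icc 0 b, ∀ x, ‖q₂ s x‖ ≤ Q₂) :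
    let Z : ℝ → T3 → ℝ := fun s x => max a₁ (min (3 / 2 * Real.log (thetaC r (Φ.flow s z) x) -
      Real.log (rhoC r (Φ.flow s z) x) - Fc (rhoC r (Φ.flow s z) x * σ ^ 3)) b₁)
    let F : ℝ → T3 → ℝ := fun s x => rhoC r (Φ.flow s z) x * Z s x * q₁ s x + Z s x * ⟪momC r (Φ.flow s z) x, q₂ s x⟫_ℝ
    (∀ s ∈ Icc 0 b, Integrable (F s) volume) ∧
    (∀ s ∈ Icc 0 b, |∫ x, F s x| ≤ 0 + max |a₁| |b₁| * Q₂ * ke z + (max |a₁| |b₁| * Q₁ + max |a₁| |b₁| * Q₂ / 2)) ∧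
    IntegrableOn (fun s => ∫ x, F s x) (Icc 0 b) volume ∧
    |∫ s in Icc 0 b, ∫ x, F s x| ≤ (b - 0) * (0 + max |a₁| |b₁| * Q₂ * ke z + (max |a₁| |b₁| * Q₁ + max |a₁| |b₁| * Q₂ / 2)) := by
  intro Z F
  have hγ : Measurable fun s => Φ.flow s z := (Φ.isTrajectory z hz).measurable_torus
  have mZ : Measurable fun p : ℝ × T3 => Z p.1 p.2 := measurable_clampL_orbit hγ hr (pow_nonneg hσ 3) a₁ b₁ hFc
  obtain ⟨mρ, mm, -⟩ := orbit_factors Φ hz hr (χe := fun _ => (0 : ℝ)) continuousOn_const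
  have hZb : ∀ s x, |Z s x| ≤ max |a₁| |b₁| := fun s x => abs_clamp_le _ _ _
  have hQ₁0 : 0 ≤ Q₁ := (abs_nonneg _).trans (hQ₁ 0 ⟨le_rfl, hb⟩ 0)
  have hQ₂0 : 0 ≤ Q₂ := (norm_nonneg _).trans (hQ₂ 0 ⟨le_rfl, hb⟩ 0)
  have hstrip : AEStronglyMeasurable (uncurry F) ((volume.restrict (Icc 0 b)).prod volume) :=
    (aemeasurable_entropy_recipe mρ.aemeasurable mZ.aemeasurable (classical_factor hq₁).1.aemeasurable
      mm.aemeasurable (classical_factor hq₂).1.aemeasurable).aestronglyMeasurable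
  have hsec : ∀ s ∈ Icc 0 b, AEStronglyMeasurable (F s) volume := fun s hs =>
    (aemeasurable_entropy_recipe (orbit_factor mρ b |>.2 s).aemeasurable
      ((mZ.comp (measurable_const.prodMk measurable_id)).aemeasurable)
      ((classical_factor hq₁).2 s hs).measurable.aemeasurable (orbit_factor mm b |>.2 s).aemeasurable
      ((classical_factor hq₂).2 s hs).measurable.aemeasurable).aestronglyMeasurable
  exact spaceTime_bounds Φ hz hr hr2 hb (F := F) hstrip hsec (by positivity) (by positivity) fun s hs x => by
    have h := abs_entropyIntegrand_le hr (Φ.flow s z) x (hZb s x) (hQ₁ s hs x) (hQ₂ s hs x)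
    have e : (max |a₁| |b₁| * Q₁ + max |a₁| |b₁| * Q₂ / 2) * rhoC r (Φ.flow s z) x + max |a₁| |b₁| * Q₂ * kinC r (Φ.flow s z) x
        = 0 + max |a₁| |b₁| * Q₂ * kinC r (Φ.flow s z) x + (max |a₁| |b₁| * Q₁ + max |a₁| |b₁| * Q₂ / 2) * rhoC r (Φ.flow s z) x := by
      ring
    exact h.trans_eq e

include hσ hz hr hr2 hb hFc in
/-- **Two entropy double integrals with the same weight and nearby data are close**:
`|∫∫(ρ_r Z q₁ + Z⟪m_r, q₂⟫) − ∫∫(ρ_r Z q₁' + Z⟪m_r, q₂'⟫)| ≤ b (Z_m D₂ ke + Z_m D₁ + Z_m D₂/2)` when `|q₁ − q₁'| ≤ D₁`,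
`‖q₂ − q₂'‖ ≤ D₂` on the strip. [folklore] -/
theorem entropy_sub {q₁ q₁' : ℝ → T3 → ℝ} {q₂ q₂' : ℝ → T3 → V3}
    (hq₁ : ContinuousOn (uncurry q₁) (Icc 0 b ×ˢ univ)) (hq₂ : ContinuousOn (uncurry q₂) (Icc 0 b ×ˢ univ))
    (hq₁' : ContinuousOn (uncurry q₁') (Icc 0 b ×ˢ univ)) (hq₂' : ContinuousOn (uncurry q₂') (Icc 0 b ×ˢ univ))
    {Q₁ Q₂ : ℝ} (hQ₁ : ∀ s ∈ Icc 0 b, ∀ x, |q₁ s x| ≤ Q₁) (hQ₂ : ∀ s ∈ Icc 0 b, ∀ x, ‖q₂ s x‖ ≤ Q₂)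
    (hQ₁' : ∀ s ∈ Icc 0 b, ∀ x, |q₁' s x| ≤ Q₁) (hQ₂' : ∀ s ∈ Icc 0 b, ∀ x, ‖q₂' s x‖ ≤ Q₂)
    {D₁ D₂ : ℝ} (hD₁ : ∀ s ∈ Icc 0 b, ∀ x, |q₁ s x - q₁' s x| ≤ D₁) (hD₂ : ∀ s ∈ Icc 0 b, ∀ x, ‖q₂ s x - q₂' s x‖ ≤ D₂) :
    let Z : ℝ → T3 → ℝ := fun s x => max a₁ (min (3 / 2 * Real.log (thetaC r (Φ.flow s z) x) -
      Real.log (rhoC r (Φ.flow s z) x) - Fc (rhoC r (Φ.flow s z) x * σ ^ 3)) b₁)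
    |(∫ s in Icc 0 b, ∫ x, (rhoC r (Φ.flow s z) x * Z s x * q₁ s x + Z s x * ⟪momC r (Φ.flow s z) x, q₂ s x⟫_ℝ)) -
      ∫ s in Icc 0 b, ∫ x, (rhoC r (Φ.flow s z) x * Z s x * q₁' s x + Z s x * ⟪momC r (Φ.flow s z) x, q₂' s x⟫_ℝ)| ≤
      (b - 0) * (0 + max |a₁| |b₁| * D₂ * ke z + (max |a₁| |b₁| * D₁ + max |a₁| |b₁| * D₂ / 2)) := by
  intro Z
  obtain ⟨i1, -, p1, -⟩ := entropy_integrands hσ Φ hz hr hr2 hb hFc hq₁ hq₂ hQ₁ hQ₂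
  obtain ⟨i2, -, p2, -⟩ := entropy_integrands hσ Φ hz hr hr2 hb hFc hq₁' hq₂' hQ₁' hQ₂'
  obtain ⟨-, -, -, pd⟩ := entropy_integrands hσ Φ hz hr hr2 hb hFc (q₁ := fun s x => q₁ s x - q₁' s x)
    (q₂ := fun s x => q₂ s x - q₂' s x) (hq₁.sub hq₁') (hq₂.sub hq₂') hD₁ hD₂
  beta_reduce at i1 p1 i2 p2 pd
  have e1 := integral_sub (μ := volume.restrict (Icc 0 b)) p1 p2
  rw [← e1]
  have hx : ∀ s ∈ Icc 0 b, (∫ x, (rhoC r (Φ.flow s z) x * Z s x * q₁ s x + Z s x * ⟪momC r (Φ.flow s z) x, q₂ s x⟫_ℝ)) -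
      (∫ x, (rhoC r (Φ.flow s z) x * Z s x * q₁' s x + Z s x * ⟪momC r (Φ.flow s z) x, q₂' s x⟫_ℝ)) =
      ∫ x, (rhoC r (Φ.flow s z) x * Z s x * (q₁ s x - q₁' s x) + Z s x * ⟪momC r (Φ.flow s z) x, q₂ s x - q₂' s x⟫_ℝ) := by
    intro s hs
    rw [← integral_sub (i1 s hs) (i2 s hs)]
    refine integral_congr_ae (ae_of_all _ fun x => ?_)
    beta_reduce
    rw [inner_sub_right]; ring
  rw [setIntegral_congr_fun measurableSet_Icc hx]
  exact pd

end Orbit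

/-! ## §2 The test of the window starting at `τ₀` -/

section Test

variable {T : ℝ} {θ : ℝ → T3 → ℝ} (hθ : Torus.IsSmoothSpaceTimeOn (Ico 0 T) θ) {e Δ τ₀ : ℝ} (he : 0 < e) (hΔ : 0 < Δ)

/-- The ramp vanishes below `−e/2`. [folklore] -/
theorem ramp_eq_zero {e s : ℝ} (he : 0 < e) (hs : s ≤ -(e / 2)) : Real.smoothTransition ((s + e / 2) / (e / 4)) = 0 :=
  Real.smoothTransition.zero_of_nonpos (div_nonpos_of_nonpos_of_nonneg (by linarith) (by linarith))

/-- The ramp equals `1` above `−e/4`. [folklore] -/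
theorem ramp_eq_one {e s : ℝ} (he : 0 < e) (hs : -(e / 4) ≤ s) : Real.smoothTransition ((s + e / 2) / (e / 4)) = 1 :=
  Real.smoothTransition.one_of_one_le (by rw [le_div_iff₀ (by linarith)]; linarith)

/-- The ramp equals `1` near every `s ≥ 0`. [folklore] -/
theorem ramp_eventually_one {e s : ℝ} (he : 0 < e) (hs : 0 ≤ s) :
    ∀ᶠ s' in 𝓝 s, Real.smoothTransition ((s' + e / 2) / (e / 4)) = 1 := by
  filter_upwards [Ioi_mem_nhds (by linarith : -(e / 4) < s)] with s' hs'
  exact ramp_eq_one he (le_of_lt hs')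

include hθ he hΔ in
/-- **The test is smooth on all of space–time** (`τ₀ + Δ + e < T`). [folklore] -/
theorem entropyTest_smooth (hτ : τ₀ + Δ + e < T) :
    Torus.IsSmoothSpaceTimeOn Set.univ fun s x =>
      Real.smoothTransition ((s + e / 2) / (e / 4)) * θ (s + e) x * Real.smoothTransition ((τ₀ + Δ - s) / Δ) := by
  have hw := isSmoothSpaceTimeOn_shift hθ e
  have hζ : ContDiff ℝ ∞ fun s : ℝ => Real.smoothTransition ((s + e / 2) / (e / 4)) * Real.smoothTransition ((τ₀ + Δ - s) / Δ) :=
    (Real.smoothTransition.contDiff.comp ((contDiff_id.add contDiff_const).div_const _)).mul (contDiff_cut τ₀ Δ)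
  have h := isSmoothSpaceTimeOn_univ_mul hw hζ (a := -(e / 2)) (d := τ₀ + Δ) (by linarith) (by linarith)
    (fun s hs => by rw [ramp_eq_zero he hs, zero_mul]) (fun s hs => by rw [cut_eq_zero hΔ hs, mul_zero])
  have heq : (fun s x => Real.smoothTransition ((s + e / 2) / (e / 4)) * θ (s + e) x * Real.smoothTransition ((τ₀ + Δ - s) / Δ)) =
      fun s x => Real.smoothTransition ((s + e / 2) / (e / 4)) * Real.smoothTransition ((τ₀ + Δ - s) / Δ) * θ (s + e) x := by
    funext s x; ring
  rw [heq]; exact h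

include he hΔ in
/-- **The test is nonnegative** when `θ > 0` on `[0, T) × 𝕋³` (`τ₀ + Δ + e ≤ T`). [folklore] -/
theorem entropyTest_nonneg (hθpos : ∀ s ∈ Ico 0 T, ∀ x, 0 < θ s x) (hτ : τ₀ + Δ + e ≤ T) (s : ℝ) (x : T3) :
    0 ≤ Real.smoothTransition ((s + e / 2) / (e / 4)) * θ (s + e) x * Real.smoothTransition ((τ₀ + Δ - s) / Δ) := by
  by_cases h1 : s + e < 0
  · rw [ramp_eq_zero he (by linarith), zero_mul, zero_mul]
  by_cases h2 : τ₀ + Δ ≤ s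
  · rw [cut_eq_zero hΔ h2, mul_zero]
  push Not at h1 h2
  exact mul_nonneg (mul_nonneg (Real.smoothTransition.nonneg _) (hθpos _ ⟨h1, by linarith⟩ x).le)
    (Real.smoothTransition.nonneg _)

include hΔ in
/-- **The test vanishes from `τ₀ + Δ` on.** [folklore] -/
theorem entropyTest_vanish (s : ℝ) (hs : τ₀ + Δ ≤ s) (x : T3) :
    Real.smoothTransition ((s + e / 2) / (e / 4)) * θ (s + e) x * Real.smoothTransition ((τ₀ + Δ - s) / Δ) = 0 := by
  rw [cut_eq_zero hΔ hs, mul_zero]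

include he in
/-- **The test at time `0`.** [folklore] -/
theorem entropyTest_zero (x : T3) :
    Real.smoothTransition (((0 : ℝ) + e / 2) / (e / 4)) * θ (0 + e) x * Real.smoothTransition ((τ₀ + Δ - 0) / Δ) =
      θ (0 + e) x * Real.smoothTransition ((τ₀ + Δ - 0) / Δ) := by
  rw [ramp_eq_one he (by linarith), one_mul]

include hθ he in
/-- **The time derivative of the test** at `s ≥ 0` with `s + e < T`. [folklore] -/
theorem entropyTest_timeDeriv {s : ℝ} (hs0 : 0 ≤ s) (hsT : s + e < T) (x : T3) :
    Torus.timeDeriv (fun s' y => Real.smoothTransition ((s' + e / 2) / (e / 4)) * θ (s' + e) y *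
      Real.smoothTransition ((τ₀ + Δ - s') / Δ)) s x =
      Torus.timeDerivWithin (Ico 0 T) θ (s + e) x * Real.smoothTransition ((τ₀ + Δ - s) / Δ) +
        θ (s + e) x * (deriv Real.smoothTransition ((τ₀ + Δ - s) / Δ) * (-Δ⁻¹)) :=
  timeDeriv_shiftTest hθ τ₀ Δ e (ramp_eventually_one he hs0) ⟨by linarith, hsT⟩ x

include hθ he in
/-- **The gradient of the test** at `s ≥ 0` with `s + e < T`. [folklore] -/
theorem entropyTest_gradient {s : ℝ} (hs0 : 0 ≤ s) (hsT : s + e < T) (x : T3) :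
    Torus.gradient (fun y => Real.smoothTransition ((s + e / 2) / (e / 4)) * θ (s + e) y *
      Real.smoothTransition ((τ₀ + Δ - s) / Δ)) x =
      Real.smoothTransition ((τ₀ + Δ - s) / Δ) • Torus.gradient (θ (s + e)) x := by
  rw [gradient_shiftTest hθ (fun s => Real.smoothTransition ((s + e / 2) / (e / 4))) τ₀ Δ e ⟨by linarith, hsT⟩ x,
    ramp_eq_one he (by linarith), one_mul]

include hΔ in
/-- **Past `τ₀ + Δ` the test's time derivative and gradient vanish.** [folklore] -/
theorem entropyTest_derivs_zero {s : ℝ} (hs : τ₀ + Δ < s) (x : T3) :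
    Torus.timeDeriv (fun s' y => Real.smoothTransition ((s' + e / 2) / (e / 4)) * θ (s' + e) y *
      Real.smoothTransition ((τ₀ + Δ - s') / Δ)) s x = 0 ∧
    Torus.gradient (fun y => Real.smoothTransition ((s + e / 2) / (e / 4)) * θ (s + e) y *
      Real.smoothTransition ((τ₀ + Δ - s) / Δ)) x = 0 := by
  refine ⟨timeDeriv_eq_zero_of_eventually x ?_, gradient_eq_zero_of_forall (fun y => entropyTest_vanish hΔ s hs.le y) x⟩
  filter_upwards [Ioi_mem_nhds hs] with s' hs'
  exact entropyTest_vanish hΔ s' (le_of_lt hs') x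

end Test

/-! ## §3 The registered sub-goal -/

/-- **Registered sub-goal `stub_reductionEntropyA` (helper of `stub_kineticReduction`): the ramp of the entropy
tests equals `1` above `−e/4`** — so on `[0, ∞)` the test is the shifted temperature times the shell's cut-off.
[folklore] -/
theorem stub_reductionEntropyA : ∀ {e s : ℝ}, 0 < e → -(e / 4) ≤ s → Real.smoothTransition ((s + e / 2) / (e / 4)) = 1 :=
  fun he hs => ramp_eq_one he hs

end Summit.AtomisticToContinuum.HydrodynamicLimit.Theorems.ChaosClosesEulerReduction

end
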